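import Summits.BirchSwinnertonDyer.BirchSwinnertonDyer.Theorems.GenusKolyvaginAtTwoEquivariantKolyvaginExactAtTwoRTOnCut
import HarnessLib

/-!
# Route `GenusKolyvaginAtTwo`, crux Q3R_T `EquivariantKolyvaginExactAtTwoRT` (rev 39, stmt-BirchSwinnertonDyer-23468) — CLOSED BY NAME:
# Kolyvagin's exact formula at 2, `#Ш(E/K)[2^∞] = 2^(2M₀)`, on the (D-NPh)/(β″) habitat cut to the live configuration

Seat `bsd-line-gk2-p1` g19 (LEAD, cell `bsd-f1-sign2`), `--workitem stmt-BirchSwinnertonDyer-23468`.  THEOREMS ONLY (no definition, no named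
fact, no `sorry`).  Rev 39 (route pen bsd-idea-1 g21, R7-d) cut Q3R_T to the live configuration (`W.rootNumber = 1`, a globally minimal elliptic model
`Wd ≅ E^{(d_K)}`, `#Sel₂(Wd) = 2`, `ord₂ c(Wd) ≤ 1` inserted after `hndiv`), conclusion `#Ш(E/K)[2^∞] = 2^(2M₀)` — VERBATIM the statement of this
seat's `RationalPairDescent.natCard_primaryComponent_sha_two_eq_pow_onCut` (`…EquivariantKolyvaginExactAtTwoRTOnCut`): `Nat.dvd_antisymm` of
U_T on the cut (LINE 19 `rational_pair_descent`: PAIRCOUNT gk2-p4 g22 p749270 × SANDWICH′ this seat p750599 × `#X = 4^t` gk2-p5 g29) and the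
CLOSED L_T (`Theorems.powDvdShaCardAtTwoRT_proof`, gk2-p4 g21 p744020).  The planner's glue 23243 (`…RTOfHalves`) gives the same once re-landed;
this file closes the crux directly.  UNCONDITIONAL modulo the in-signature antecedents (Q2 `KolyvaginRelationAtTwo` is used by both halves; Q5R /
the Q1-shape clause as L_T uses them).  **BSD is NOT proved by this**; rung K4 `NonCMAtTwo` is NOT proved by this (the supply crux
`GenusDeepSupplyAtTwoNegDisc` 23467 and the parents above Q3R_T remain).

References: [McCallumLMS1991] §5 Thm. 5.4, Cor. 5.6, Thm. 5.8; [Kolyvagin1990] Thm. A; [Kolyvagin1991MathAnn]; [GrossLMS1991] §5; [Kramer1981] Thm. 1.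
-/

set_option autoImplicit false
-- the Theorems namespace of this sub repeats the summit name by design (D-0017 nested layout)
set_option linter.dupNamespace false

noncomputable section

namespace Summit.BirchSwinnertonDyer.BirchSwinnertonDyer.Theorems

open Summit.BirchSwinnertonDyer.BirchSwinnertonDyer.Theses.GenusKolyvaginAtTwo

/-- **Q3R_T `EquivariantKolyvaginExactAtTwoRT` (rev 39) holds**: on the habitat cut to the live configuration, `#Ш(E/K)[2^∞] = 2^(2M₀)` —
`RationalPairDescent.natCard_primaryComponent_sha_two_eq_pow_onCut` by name (the route decl unfolds to its statement verbatim).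
BSD is NOT proved by this.  [cite: McCallumLMS1991, §5 Thm. 5.4, Cor. 5.6, Thm. 5.8] [cite: Kolyvagin1990, Thm. A] [cite: GrossLMS1991, §5] -/
theorem equivariantKolyvaginExactAtTwoRT_proof : EquivariantKolyvaginExactAtTwoRT := by
  unfold EquivariantKolyvaginExactAtTwoRT
  exact GenusExact.RationalPairDescent.natCard_primaryComponent_sha_two_eq_pow_onCut

end Summit.BirchSwinnertonDyer.BirchSwinnertonDyer.Theorems

end
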